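import Summits.CriticalPhenomena.PercolationContinuityZ3.Theorems.PercNearOneGluingNoHeavyLowerTailThreePointVarianceGladkovRegime
import Mathlib.Tactic.Linarith
import Mathlib.Tactic.Ring
import HarnessLib

/-!
# The three-point variance row `(3PT)` in "x-form": `3·μ(abc) ≤ μ(ac) + μ(bc) + μ(ab)²`

Support file for crux `stmt-CriticalPhenomena-4575` (`NoHeavyLowerTail`), seat `prim-l12-p6` gen 21
(`--supports stmt-CriticalPhenomena-4575`).  Memo
`run/shared/lean/prim/prim-l12/FROM-prim-l12-p6-g21-CUBE-FP0-REFUTED-AND-HYBRID-LP.md`.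

Bond percolation `μ = prodBernoulli w` on a finite vertex type, vertices `a b c`, cells `x = μ(abc)`,
`s = μ(ab|c)`, `t = μ(ac|b)`, `u = μ(a|bc)`, `q = μ(a|b|c)`, `θ = μ(a↔b) = x + s`.  The open row

  `(3PT)   θ(1 − θ) ≤ s + t + u`

(`Var(1_{a↔b}) ≤ μ(exactly two clusters among a,b,c)`; proved so far on the classes of
`…ThreePointVarianceTwoNeighbourReduction/GZRegime/…`) is, since `θ − θ² ≤ (θ − x) + t + u ⟺ x ≤ θ² + t + u`
and `t = μ(a↔c) − x`, `u = μ(b↔c) − x`, EQUIVALENT to a bound of the three-point function by two-point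
functions:

  `(3PT-x)   3·μ(a↔b, a↔c) ≤ μ(a↔c) + μ(b↔c) + μ(a↔b)²`.

For comparison, Gladkov–Zimin's theorem [cite: GladkovZimin2024, Thm. 4.6] (tree:
`Literature.Probability.Percolation.gladkovZimin2024_threePoint_prodBernoulli`), read with apex `c`, is the same
statement with the roles of the square exchanged: `2·μ(abc) ≤ μ(a↔b) + μ(a↔c ∪ b↔c)²` (`gz46_xform` below,
PROVED).  Both have the shape `μ(abc) ≤ μ(E)² + μ(U ∖ E)` for an up-set `E ∋ abc` of the partition lattice of
`{a,b,c}` and `U` = "exactly two clusters": `E = {a↔b}` gives `(3PT)`, `E = {c↔a} ∪ {c↔b}` gives GZ Thm 4.6;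
the two extreme members `E = {abc}` (`q ≤ (1−x)²`) and `E = Uᶜᶜ…= ¬(a|b|c)` (`x ≤ (1−q)²`) are FALSE on small
graphs (memo §6), so a proof of `(3PT)` must use the middle structure.

Main results (all [this work] except the cited GZ input): `xform_algebra`, `threePointVariance_iff_xform`,
`gz46_xform`.
-/

namespace Summit.CriticalPhenomena.PercolationContinuityZ3.Theorems.ThreePointVarianceXForm

open MeasureTheory Set
open Literature.Probability.Percolation Literature.Probability.LatticeModels
open Summit.CriticalPhenomena.PercolationContinuityZ3.Theorems.ThreePointVarianceGladkovRegime (cells_eq)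

/-- **The algebra of the x-form.**  With `θ = X = μ(ab)`, `Y = μ(ac)`, `Z = μ(bc)`, `T = μ(abc)` and the cells
`s = X − T`, `t = Y − T`, `u = Z − T`: `X(1−X) ≤ s + t + u ⟺ 3T ≤ Y + Z + X²`. [this work] -/
theorem xform_algebra (X Y Z T : ℝ) :
    X * (1 - X) ≤ (X - T) + (Y - T) + (Z - T) ↔ 3 * T ≤ Y + Z + X ^ 2 := by
  constructor
  · intro h; nlinarith [h]
  · intro h; nlinarith [h]

variable {V : Type*} [Fintype V]

/-- **`(3PT)` ⟺ `(3PT-x)` on every finite weighted graph.**  For `μ = prodBernoulli w` and vertices `a b c`: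
`μ(a↔b)·μ(a↮b) ≤ μ(ab|c) + μ(ac|b) + μ(a|bc)`  ↔  `3·μ(a↔b ∧ a↔c) ≤ μ(a↔c) + μ(b↔c) + μ(a↔b)²`.
(Pure bookkeeping via `ThreePointVarianceGladkovRegime.cells_eq`.) [this work] -/
theorem threePointVariance_iff_xform (w : Sym2 V → unitInterval) (a b c : V) :
    (prodBernoulli w).real (openConn a b) * (prodBernoulli w).real (openConn a b)ᶜ ≤
        (prodBernoulli w).real (openConn a b ∩ (openConn a c)ᶜ) +
          (prodBernoulli w).real (openConn a c ∩ (openConn a b)ᶜ) +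
          (prodBernoulli w).real (openConn b c ∩ (openConn a b)ᶜ) ↔
      3 * (prodBernoulli w).real (openConn a b ∩ openConn a c) ≤
        (prodBernoulli w).real (openConn a c) + (prodBernoulli w).real (openConn b c) +
          (prodBernoulli w).real (openConn a b) ^ 2 := by
  classical
  obtain ⟨_, _, cA, u₃, u₂, u₁, _, _, _, _⟩ := cells_eq w a b c
  rw [cA, u₃, u₂, u₁]
  exact xform_algebra _ _ _ _

/-- **Gladkov–Zimin's Theorem 4.6 in x-form** (apex `c`): `2·μ(a↔b ∧ a↔c) ≤ μ(a↔b) + μ(a↔c ∪ b↔c)²` on every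
finite weighted graph — the proved twin of `(3PT-x)`.  Input: [cite: GladkovZimin2024, Thm. 4.6] via the tree
theorem `gladkovZimin2024_threePoint_prodBernoulli` (`μ(c|a ∩ c|b)·μ(ca ∪ cb) ≤ μ(ca|b) + μ(cb|a) + μ(c|ab)`);
the translation to x-form is [this work]. -/
theorem gz46_xform (w : Sym2 V → unitInterval) (a b c : V) :
    2 * (prodBernoulli w).real (openConn a b ∩ openConn a c) ≤
      (prodBernoulli w).real (openConn a b) + (prodBernoulli w).real (openConn a c ∪ openConn b c) ^ 2 := by
  classical
  obtain ⟨_, _, _, u₃, u₂, u₁, _, _, _, _⟩ := cells_eq w a b c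
  have hGZ := gladkovZimin2024_threePoint_prodBernoulli w c a b
  have eca : (openConn c a : Set (BondConfig V)) = openConn a c := by
    ext ω
    exact ⟨fun h' => SimpleGraph.Reachable.symm h', fun h' => SimpleGraph.Reachable.symm h'⟩
  have ecb : (openConn c b : Set (BondConfig V)) = openConn b c := by
    ext ω
    exact ⟨fun h' => SimpleGraph.Reachable.symm h', fun h' => SimpleGraph.Reachable.symm h'⟩
  have e1 : (openConn c a ∩ (openConn c b)ᶜ : Set (BondConfig V)) = openConn a c ∩ (openConn a b)ᶜ := by
    ext ω
    simp only [Set.mem_inter_iff, Set.mem_compl_iff]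
    constructor
    · rintro ⟨hca, hcb⟩
      exact ⟨SimpleGraph.Reachable.symm hca, fun hab => hcb (SimpleGraph.Reachable.trans hca hab)⟩
    · rintro ⟨hac, hab⟩
      exact ⟨SimpleGraph.Reachable.symm hac,
        fun hcb => hab (SimpleGraph.Reachable.trans hac hcb)⟩
  have e2 : (openConn c b ∩ (openConn c a)ᶜ : Set (BondConfig V)) = openConn b c ∩ (openConn a b)ᶜ := by
    ext ω
    simp only [Set.mem_inter_iff, Set.mem_compl_iff]
    constructor
    · rintro ⟨hcb, hca⟩
      exact ⟨SimpleGraph.Reachable.symm hcb,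
        fun hab => hca (SimpleGraph.Reachable.trans hcb (SimpleGraph.Reachable.symm hab))⟩
    · rintro ⟨hbc, hab⟩
      exact ⟨SimpleGraph.Reachable.symm hbc,
        fun hca => hab (SimpleGraph.Reachable.trans (SimpleGraph.Reachable.symm hca) (SimpleGraph.Reachable.symm hbc))⟩
  have e3 : ((openConn c a)ᶜ ∩ (openConn c b)ᶜ ∩ openConn a b : Set (BondConfig V)) =
      openConn a b ∩ (openConn a c)ᶜ := by
    ext ω
    simp only [Set.mem_inter_iff, Set.mem_compl_iff]
    constructor
    · rintro ⟨⟨hca, _⟩, hab⟩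
      exact ⟨hab, fun hac => hca (SimpleGraph.Reachable.symm hac)⟩
    · rintro ⟨hab, hac⟩
      exact ⟨⟨fun hca => hac (SimpleGraph.Reachable.symm hca),
        fun hcb => hac (SimpleGraph.Reachable.trans hab (SimpleGraph.Reachable.symm hcb))⟩, hab⟩
  have mEac : MeasurableSet (openConn a c : Set (BondConfig V)) := MeasurableSet.of_discrete
  have mEbc : MeasurableSet (openConn b c : Set (BondConfig V)) := MeasurableSet.of_discrete
  -- `μ((ca)ᶜ ∩ (cb)ᶜ) = 1 − μ(ac ∪ bc)`
  have e4 : ((openConn c a)ᶜ ∩ (openConn c b)ᶜ : Set (BondConfig V)) = (openConn a c ∪ openConn b c)ᶜ := by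
    rw [eca, ecb, Set.compl_union]
  have e5 : (openConn c a ∪ openConn c b : Set (BondConfig V)) = openConn a c ∪ openConn b c := by
    rw [eca, ecb]
  rw [e1, e2, e3, e4, e5] at hGZ
  have hcompl : (prodBernoulli w).real (openConn a c ∪ openConn b c)ᶜ =
      1 - (prodBernoulli w).real (openConn a c ∪ openConn b c) := by
    rw [measureReal_compl (mEac.union mEbc), probReal_univ]
  -- the union in terms of the basic masses
  have hTI : (openConn a c ∩ openConn b c : Set (BondConfig V)) = openConn a b ∩ openConn a c := by
    ext ω
    constructor
    · rintro ⟨hac, hbc⟩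
      exact ⟨SimpleGraph.Reachable.trans hac (SimpleGraph.Reachable.symm hbc), hac⟩
    · rintro ⟨hab, hac⟩
      exact ⟨hac, SimpleGraph.Reachable.trans (SimpleGraph.Reachable.symm hab) hac⟩
  have hU : (prodBernoulli w).real (openConn a c ∪ openConn b c) =
      (prodBernoulli w).real (openConn a c) + (prodBernoulli w).real (openConn b c) -
        (prodBernoulli w).real (openConn a b ∩ openConn a c) := by
    have h := measureReal_union_add_inter (μ := prodBernoulli w) (s := openConn a c) mEbc
    rw [hTI] at h
    linarith
  rw [hcompl, u₃, u₂, u₁] at hGZ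
  set X := (prodBernoulli w).real (openConn a b) with hX
  set Y := (prodBernoulli w).real (openConn a c) with hY
  set Z := (prodBernoulli w).real (openConn b c) with hZ
  set G := (prodBernoulli w).real (openConn a c ∪ openConn b c) with hG
  set TT := (prodBernoulli w).real (openConn a b ∩ openConn a c) with hTT
  -- hGZ : (1 - G) * G ≤ (X - TT) + (Y - TT) + (Z - TT), and G = Y + Z - TT
  nlinarith [hGZ, hU]

end Summit.CriticalPhenomena.PercolationContinuityZ3.Theorems.ThreePointVarianceXForm
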